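import Literature.Computability.Cryptography.PeikertBDDIdealised
import Literature.Algebra.EuclideanLattices.RegevSmoothingLowerBound
import Literature.Algebra.EuclideanLattices.LatticeProblemsProofs
import HarnessLib

/-!
# Peikert 2009, Prop. 3.2 with a DETERMINISTIC verification: the direct `BDD → LWE` experiment and its failure bound

Topic `Computability/Cryptography` (family `pqc`), grouping namespaces `Regev2009` (generic block lemmas)
and `Peikert2009` (the experiment on a slack-admissible input). Law-level analysis of the second component
`h₂` of `peikert_gapSVPZeta_to_lwe_classical_of_bddSolverS` (`PeikertMachineH1S.lean`; named fact
`Literature.Computability.Cryptography.peikert_gapSVPZeta_to_lwe_classical`, pqc.S20) along a line that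
keeps the machine small. Everything here is PROVED; the definitions have bodies; no named fact.

Regev's `BDD → LWE` reduction (Lemma 3.4 = Peikert's Prop. 3.2; the tree's idealised experiment
`Regev2009.regevBDD`, `RegevBDDToLWEIdealised.lean`) finds the secret `s = B⁻¹κ mod q` with an average-case
oracle by trying the `(K_g+1)·J` blocks of a grid (unknown noise width, Lemma 3.7; Lemma 4.1's random
shift) and VERIFYING each candidate (Lemma 3.6, a statistical cosine test on fresh fine samples). In
Peikert's regime the verification can be made DETERMINISTIC:

* **uniqueness** (`Peikert2009.eq_closest_of_norm_sub_le`): on an `f`-admissible input `((B, x), r)`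
  the smoothing condition `√2·q·η_{2⁻ⁿ}(Λ*) ≤ r` and Regev's Claim 2.13 (tree:
  `Regev2009.sqrt_log_div_minNorm_dual_le_smoothingParameter`, `(Λ*)* = Λ`) give
  `λ₁(Λ) ≥ √2·q·√(n ln 2/π)/r > 2·αq/(√2 r)` for `n ≥ 5`, `α ≤ 1`; so the closest vector `κ` is the
  ONLY lattice vector within `αq/(√2 r)` of `x`, and the candidate test "`‖x - B·digitOutput(c)‖² ≤
  α²q²/(2r²)`" (`Peikert2009.distAcc`, exact rational arithmetic for a machine) accepts `c` iff `c = s`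
  (`distAcc_eq_empty`, `distAcc_self`): error bounds `(η_A, η_R) = (0, 0)`, no fine samples (`N_V = 0`).
* **per-block slack** (`Regev2009.toReal_firstAccepted_ne_le_of_tvDist`): with a test that never accepts
  a wrong candidate, the output is wrong only if EVERY block of the fitting level fails, so a product of
  REAL block laws each within `τ` of the ideal block fails with probability `≤ (1 - σ + τ)^J` — the
  samplers of a machine need only `τ = O(1)` accuracy per block, not a negligible one.
* **`π`-free widths** (`Peikert2009.directWidth r = r√(π/3) ∈ [r, 8r/7]`, `Peikert2009.levelParam α T k =
  √(π(4α²/25 + kα²/T))`): all Gaussian weights a machine evaluates are `e^{-θ(j-c)²}` with `θ, c ∈ ℚ`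
  (`e^{-π‖v‖²/r'²} = e^{-3‖v‖²/r²}`, `e^{-πe²/α_k²} = e^{-e²/(4α²/25+kα²/T)}`); the price is the factor
  `8/7 · 3/4 = 6/7` in Regev's distance hypothesis, paid by the slack of `BDDAdmissibleS`; the level grid
  `u + k·πα²/T` is handled by `Regev2009.exists_level_of_grid` (crude bounds `3 < π < 3.15` only).

Main result **`Peikert2009.toReal_directOutput_ne_le`**: on a slack-admissible input of dimension
`n ≥ 5` (`0 < α ≤ 1`, `√2·α < f√(log n)`), for every lattice sampler `D` within `δ` of `D_{Λ*,r'}`, every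
oracle `F` with average-case success `≥ 2/3` on `LWE_{q,Ψ̄_α}` from `m` samples, `T ≥ 100m`,
`T + 3 ≤ 3K_g`, and every family of real block laws `P_j` within `τ` of the blocks `directBlock`
(uniform shift, `m` manufactured samples at the block's level), if `m(δ + 6·2⁻ⁿ) + τ ≤ 1/10` then
`Pr_{⊗P}[directOutput ≠ some (B⁻¹κ)] ≤ 2^{-J}`, `κ` the closest vector (`coeffVec B (B⁻¹κ)` codes a `CVP`
solution with factor `1`, `isSolution_coeffVec_repr`).

## References

* C. Peikert, *Public-key cryptosystems from the worst-case shortest vector problem*, STOC 2009,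
  Prop. 3.2, Lemma 2.3, Prop. 2.8 and the proof of Thm. 3.1 (full version pp. 8–12) [Peikert2009].
* O. Regev, *On lattices, learning with errors, random linear codes, and cryptography*, J. ACM 56
  (2009), art. 34, Lemma 3.4 with Lemmas 3.5, 3.7, 3.11, 4.1 and Claims 2.2, 2.13 [RegevLWE2009].
-/

noncomputable section

open Finset Module MeasureTheory Metric
open scoped ENNReal Real InnerProductSpace

namespace Literature.Computability.Cryptography

/-! ## Generic block lemmas -/

namespace Regev2009

open Literature.Probability.Distributions Literature.Probability.Moments LWE

section Blocks

variable {ι : Type} [Fintype ι] [DecidableEq ι] {q K : ℕ} [NeZero q] {m NV : ℕ}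

/-- **The failure bound with a deterministic test, over a product of real block laws.** Blocks `j < n_B`
independent with ARBITRARY laws `P j`, of which those in `T` are within statistical distance `τ` of the
ideal block `blockLaw (χO j) χV s`; a test `Acc` that never accepts a wrong candidate (`Acc c = ∅` for
`c ≠ s`) and always accepts `s` (`Acc s = univ`); on the blocks of `T` the oracle's average-case success
probability is `≥ σ`. Then `Pr[firstAccepted ≠ some s] ≤ (1 - σ + τ)^{|T|}`: a wrong output needs the
candidate of every block of `T` to be wrong (independence), and per block
`Pr_{P j}[candidate ≠ s] ≤ Pr_{ideal}[candidate ≠ s] + τ = 1 - searchSuccessProb + τ`.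
[cite: RegevLWE2009, Lemma 3.7 (proof) with Lemma 4.1 (proof)] -/
theorem toReal_firstAccepted_ne_le_of_tvDist {nB : ℕ}
    (P : Fin nB → PMF (((ι → ZMod q) × (Fin m → (ι → ZMod q) × ZMod q)) ×
      (Fin NV → (ι → ZMod q) × ZMod (q * K))))
    (χO : Fin nB → PMF (ZMod q)) (χV : PMF (ZMod (q * K))) (s : ι → ZMod q)
    (F : (Fin m → (ι → ZMod q) × ZMod q) → ι → ZMod q)
    (Acc : (ι → ZMod q) → Set (Fin NV → (ι → ZMod q) × ZMod (q * K)))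
    (hA : ∀ c, c ≠ s → Acc c = ∅) (hRacc : Acc s = Set.univ)
    (T : Finset (Fin nB)) {σ τ : ℝ}
    (hσ : ∀ j ∈ T, σ ≤ (searchSuccessProb (χO j) m fun B => PMF.pure (F B)).toReal)
    (hτ : ∀ j ∈ T, (P j).tvDist (blockLaw q K m NV (χO j) χV s) ≤ τ) :
    ((indepLaw nB P).toOuterMeasure {D | firstAccepted q K m NV F Acc D ≠ some s}).toReal ≤
      (1 - σ + τ) ^ T.card := by
  classical
  set Wrong : Set ((ι → ZMod q) × (Fin m → (ι → ZMod q) × ZMod q)) := {w | candidate q m F w ≠ s} with hWrong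
  set A : Fin nB → Set (((ι → ZMod q) × (Fin m → (ι → ZMod q) × ZMod q)) ×
      (Fin NV → (ι → ZMod q) × ZMod (q * K))) := fun j => if j ∈ T then Prod.fst ⁻¹' Wrong else Set.univ with hAdef
  -- a wrong output needs a wrong candidate in every block of `T`
  have hsub : {D | firstAccepted q K m NV F Acc D ≠ some s} ⊆ {D | ∀ j, D j ∈ A j} := by
    intro D hD j
    simp only [hAdef]
    split_ifs with hj
    · rcases firstAccepted_ne_some hD with ⟨j', hj', hne⟩ | hall
      · exfalso
        have h := hj'
        simp only [Accepts, hA _ hne, Set.mem_empty_iff_false] at h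
      · simp only [Set.mem_preimage, hWrong, Set.mem_setOf_eq]
        intro hc
        exact hall j ⟨by simp only [Accepts, hc, hRacc, Set.mem_univ], hc⟩
    · exact Set.mem_univ _
  -- per block of `T`: `Pr_{P j}[wrong] ≤ 1 - σ + τ`
  have hblock : ∀ j ∈ T, ((P j).toOuterMeasure (Prod.fst ⁻¹' Wrong)).toReal ≤ 1 - σ + τ := by
    intro j hj
    have hideal : ((blockLaw q K m NV (χO j) χV s).toOuterMeasure (Prod.fst ⁻¹' Wrong)).toReal ≤ 1 - σ := by
      have hfst : (blockLaw q K m NV (χO j) χV s).toOuterMeasure (Prod.fst ⁻¹' Wrong) =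
          (prodLaw (PMF.uniformOfFintype (ι → ZMod q)) (lweSamples (χO j) s m)).toOuterMeasure Wrong := by
        rw [blockLaw, ← PMF.toOuterMeasure_map_apply, prodLaw_map_fst]
      have hgood := toOuterMeasure_candidate_eq_searchSuccessProb (χO j) s F (q := q) (m := m)
      have hcompl : Wrong = {w | candidate q m F w = s}ᶜ := by ext w; simp [hWrong]
      rw [hfst, hcompl, toReal_toOuterMeasure_compl', hgood]
      linarith [hσ j hj]
    have h := PMF.abs_toReal_toOuterMeasure_sub_le_tvDist (P j) (blockLaw q K m NV (χO j) χV s) (Prod.fst ⁻¹' Wrong)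
    rw [abs_le] at h
    linarith [h.2, hτ j hj]
  have hnonneg : ∀ j ∈ T, (0 : ℝ) ≤ 1 - σ + τ := fun j hj =>
    le_trans ENNReal.toReal_nonneg (hblock j hj)
  -- independence
  calc ((indepLaw nB P).toOuterMeasure {D | firstAccepted q K m NV F Acc D ≠ some s}).toReal
      ≤ ((indepLaw nB P).toOuterMeasure {D | ∀ j, D j ∈ A j}).toReal :=
        ENNReal.toReal_mono (pmf_toOuterMeasure_ne_top _ _) (OuterMeasure.mono _ hsub)
    _ = ∏ j, ((P j).toOuterMeasure (A j)).toReal := by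
        rw [toOuterMeasure_indepLaw_pi, ENNReal.toReal_prod]
    _ = ∏ j ∈ T, ((P j).toOuterMeasure (Prod.fst ⁻¹' Wrong)).toReal := by
        rw [← prod_filter_mul_prod_filter_not univ (· ∈ T)]
        have hT : univ.filter (· ∈ T) = T := by ext j; simp
        have h1 : ∏ j ∈ univ.filter (fun j => ¬j ∈ T), ((P j).toOuterMeasure (A j)).toReal = 1 :=
          prod_eq_one fun j hj => by
            rw [mem_filter] at hj
            simp only [hAdef, if_neg hj.2]
            rw [(PMF.toOuterMeasure_apply_eq_one_iff _ _).2 (fun x _ => Set.mem_univ x), ENNReal.toReal_one]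
        rw [h1, mul_one, hT]
        refine prod_congr rfl fun j hj => ?_
        simp only [hAdef, if_pos hj]
    _ ≤ ∏ _j ∈ T, (1 - σ + τ) := prod_le_prod (fun j _ => ENNReal.toReal_nonneg) hblock
    _ = (1 - σ + τ) ^ T.card := prod_const _

end Blocks

/-! ### A level of the grid `u + k·Δ` fits the oracle's width -/

/-- **The fitting level of an arithmetic grid of variances.** For an unknown `0 ≤ u ≤ α²` and a step
`0 < Δ ≤ 3α²`, some level `k ≤ α²/Δ + 1` has `α ≤ √(u + kΔ) ≤ 2α` and then
`Δ(Ψ̄_{√(u+kΔ)}, Ψ̄_α) ≤ Δ/α²` on `ℤ_Q` for every modulus `Q` (Regev's Lemma 3.7 grid with the tree's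
Claim 2.2, `tvDist_discretizedGaussian_le`; the grid of this file has `Δ = πα²/T`).
[cite: RegevLWE2009, Lemma 3.7 (proof) with Claim 2.2] -/
theorem exists_level_of_grid (Q : ℕ) [NeZero Q] {α u Δ : ℝ} (hα : 0 < α) (hu0 : 0 ≤ u) (hu : u ≤ α ^ 2)
    (hΔ : 0 < Δ) (hΔ3 : Δ ≤ 3 * α ^ 2) {Kg : ℕ} (hKg : α ^ 2 / Δ + 1 ≤ Kg) :
    ∃ k : ℕ, k ≤ Kg ∧ α ≤ Real.sqrt (u + k * Δ) ∧ Real.sqrt (u + k * Δ) ≤ 2 * α ∧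
      (discretizedGaussian Q (Real.sqrt (u + k * Δ))).tvDist (discretizedGaussian Q α) ≤ Δ / α ^ 2 := by
  obtain ⟨k, hk1, hk2⟩ := Regev2009.exists_grid_pad hu hΔ
  have hα2 : 0 < α ^ 2 := pow_pos hα 2
  have hkle : (k : ℝ) ≤ α ^ 2 / Δ + 1 := by
    have h1 : (k : ℝ) * Δ ≤ α ^ 2 + Δ := by linarith
    rw [div_add_one hΔ.ne', le_div_iff₀ hΔ]
    linarith
  have hkKg : k ≤ Kg := by exact_mod_cast hkle.trans hKg
  set β := Real.sqrt (u + k * Δ) with hβ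
  have hlow : α ≤ β := by
    rw [hβ, ← Real.sqrt_sq hα.le]
    exact Real.sqrt_le_sqrt hk1
  have hup2 : β ≤ 2 * α := by
    rw [hβ, show 2 * α = Real.sqrt ((2 * α) ^ 2) by rw [Real.sqrt_sq (by linarith)]]
    exact Real.sqrt_le_sqrt (by nlinarith)
  have hβpos : 0 < β := hα.trans_le hlow
  refine ⟨k, hkKg, hlow, hup2, ?_⟩
  refine (by rw [PMF.tvDist_comm]; exact tvDist_discretizedGaussian_le Q hα hlow hup2 :
    (discretizedGaussian Q β).tvDist (discretizedGaussian Q α) ≤ 2 * (β / α - 1)).trans ?_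
  -- `2(β/α - 1) = 2(β² - α²)/(α(β + α)) ≤ 2Δ/(2α²)`
  have hsq : β ^ 2 = u + k * Δ := Real.sq_sqrt (by positivity)
  have hdiff : β ^ 2 - α ^ 2 ≤ Δ := by rw [hsq]; linarith
  rw [div_sub_one hα.ne', show (β - α) / α = (β ^ 2 - α ^ 2) / (α * (β + α)) by
    field_simp; ring]
  rw [show 2 * ((β ^ 2 - α ^ 2) / (α * (β + α))) = (β ^ 2 - α ^ 2) * (2 / (α * (β + α))) by ring]
  have h2 : 2 / (α * (β + α)) ≤ 1 / α ^ 2 := by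
    rw [div_le_div_iff₀ (by positivity) hα2]
    nlinarith
  calc (β ^ 2 - α ^ 2) * (2 / (α * (β + α))) ≤ Δ * (1 / α ^ 2) :=
        mul_le_mul hdiff h2 (by positivity) hΔ.le
    _ = Δ / α ^ 2 := by ring

end Regev2009


/-! ## The direct experiment on a slack-admissible input -/

namespace Peikert2009

open Literature.Probability.Distributions Literature.Probability.Moments Literature.Algebra.EuclideanLattices
  Literature.Algebra.EuclideanLattices.LatticeInstance Regev2009 LWE

/-! ### Uniqueness of the closest vector on admissible inputs -/

section Unique

variable {q : ℕ → ℕ} [∀ n, NeZero (q n)] {α f : ℕ → ℝ}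

/-- `ℝⁿ` is nontrivial for `n ≥ 1`. [folklore] -/
theorem nontrivial_euclideanSpace {n : ℕ} (hn : 1 ≤ n) : Nontrivial (EuclideanSpace ℝ (Fin n)) := by
  refine ⟨⟨0, EuclideanSpace.single ⟨0, hn⟩ 1, fun h => ?_⟩⟩
  have := congrArg (fun v : EuclideanSpace ℝ (Fin n) => v ⟨0, hn⟩) h
  simp at this

omit [∀ n, NeZero (q n)] in
/-- **`λ₁(Λ) ≥ √2·q·√(n ln 2/π)/r` on an `f`-admissible input**: the smoothing condition
`√2·q·η_{2⁻ⁿ}(Λ*) ≤ r` of `BDDAdmissible` with Regev's Claim 2.13 on `Λ*`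
(`√(ln(1/ε)/π)/λ₁((Λ*)*) ≤ η_ε(Λ*)`, `(Λ*)* = Λ`, `ε = 2⁻ⁿ`). [cite: RegevLWE2009, Claim 2.13; Peikert2009, Prop. 3.2 (hypotheses)] -/
theorem le_minNorm_of_admissible (p : GapCVPInstance) [IsZLattice ℝ p.1.I.lattice]
    (hadm : BDDAdmissible q α f p) (hn : 1 ≤ p.1.I.n) :
    Real.sqrt 2 * q p.1.I.n * Real.sqrt (p.1.I.n * Real.log 2 / π) / p.2 ≤ minNorm p.1.I.lattice := by
  obtain ⟨-, hr0, -, hη, -⟩ := hadm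
  haveI := nontrivial_euclideanSpace hn
  have hr : (0 : ℝ) < p.2 := by exact_mod_cast hr0
  have hε : (0 : ℝ) < (2⁻¹ : ℝ) ^ p.1.I.n := by positivity
  have hclaim := Regev2009.sqrt_log_div_minNorm_dual_le_smoothingParameter (dualLattice p.1.I.lattice) hε
  rw [dualLattice_dualLattice] at hclaim
  have hlog : Real.log (1 / (2⁻¹ : ℝ) ^ p.1.I.n) = p.1.I.n * Real.log 2 := by
    rw [one_div, ← inv_pow, inv_inv, Real.log_pow]
  rw [hlog] at hclaim
  have hmin : 0 < minNorm p.1.I.lattice :=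
    minNorm_pos_of_ne_bot _ (by
      intro hbot
      set z : Fin p.1.I.n → ℤ := Pi.single (⟨0, hn⟩ : Fin p.1.I.n) 1 with hz
      have h0 : p.1.I.ofCoeffs z ∈ p.1.I.lattice := p.1.I.ofCoeffs_mem_lattice _
      rw [hbot, Submodule.mem_bot, ofCoeffs_eq_zero_iff (isNonsingular_of_isZLattice p.1.I)] at h0
      have h1 : z ⟨0, hn⟩ = 0 := by rw [h0]; rfl
      rw [hz, Pi.single_eq_same] at h1
      exact one_ne_zero h1)
  -- `√2 q · (√(n ln 2/π)/λ₁) ≤ √2 q η ≤ r`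
  have h1 : Real.sqrt 2 * q p.1.I.n * (Real.sqrt (p.1.I.n * Real.log 2 / π) / minNorm p.1.I.lattice) ≤ p.2 :=
    le_trans (mul_le_mul_of_nonneg_left hclaim (by positivity)) hη
  rw [div_le_iff₀ hr]
  rw [mul_div_assoc', div_le_iff₀ hmin] at h1
  linarith

/-- **The closest vector is the only lattice vector within `αq/(√2 r)` of the target** on an
`f`-admissible input of dimension `n ≥ 5` with `α ≤ 1`: two such vectors would differ by a nonzero lattice
vector of norm `≤ √2·αq/r < √2·q·√(n ln 2/π)/r ≤ λ₁(Λ)` (`5 ln 2 > π`). [cite: Peikert2009, Prop. 3.2 (full version p. 11: "the unique `v ∈ Λ` closest to `x`")] -/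
theorem eq_closest_of_norm_sub_le (p : GapCVPInstance) [IsZLattice ℝ p.1.I.lattice]
    (hadm : BDDAdmissible q α f p) (hn : 5 ≤ p.1.I.n) (hα1 : α p.1.I.n ≤ 1)
    (κ : p.1.I.lattice) (hκ : dist p.1.targetE κ = infDist p.1.targetE p.1.I.lattice)
    {v : EuclideanSpace ℝ (Fin p.1.I.n)} (hv : v ∈ p.1.I.lattice)
    (hvx : ‖p.1.targetE - v‖ ≤ α p.1.I.n * q p.1.I.n / (Real.sqrt 2 * p.2)) :
    v = κ := by
  have hmin := le_minNorm_of_admissible p hadm (by omega)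
  obtain ⟨-, hr0, -, -, hdist⟩ := hadm
  have hr : (0 : ℝ) < p.2 := by exact_mod_cast hr0
  have hq : (0 : ℝ) < q p.1.I.n := Nat.cast_pos.2 (Nat.pos_of_ne_zero (NeZero.ne _))
  have hs2 : (0 : ℝ) < Real.sqrt 2 := Real.sqrt_pos.2 two_pos
  have hs2sq : Real.sqrt 2 * Real.sqrt 2 = 2 := Real.mul_self_sqrt zero_le_two
  by_contra hne
  -- `κ - v` is a nonzero lattice vector of norm `≤ 2ρ`
  have hmem : (κ : EuclideanSpace ℝ (Fin p.1.I.n)) - v ∈ p.1.I.lattice := p.1.I.lattice.sub_mem κ.2 hv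
  have hne0 : (κ : EuclideanSpace ℝ (Fin p.1.I.n)) - v ≠ 0 := fun h => hne (sub_eq_zero.1 h).symm
  have hle := minNorm_le_norm_of_mem_of_ne_zero p.1.I.lattice hmem hne0
  have hκx : ‖p.1.targetE - κ‖ ≤ α p.1.I.n * q p.1.I.n / (Real.sqrt 2 * p.2) := by
    rw [← dist_eq_norm, hκ]; exact hdist
  have htri : ‖(κ : EuclideanSpace ℝ (Fin p.1.I.n)) - v‖ ≤ 2 * (α p.1.I.n * q p.1.I.n / (Real.sqrt 2 * p.2)) := by
    have h := norm_sub_le ((κ : EuclideanSpace ℝ (Fin p.1.I.n)) - p.1.targetE) (v - p.1.targetE)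
    rw [sub_sub_sub_cancel_right, norm_sub_rev _ p.1.targetE, norm_sub_rev v] at h
    linarith
  -- numerics: `2αq/(√2 r) < √2 q √(n ln2/π)/r` as `α ≤ 1 < √(n ln 2/π)`
  have hlog2 := Real.log_two_gt_d9
  have hπ := Real.pi_lt_d2
  have hπ0 := Real.pi_pos
  have hn5 : (5 : ℝ) ≤ p.1.I.n := by exact_mod_cast hn
  have hbig : 1 < Real.sqrt (p.1.I.n * Real.log 2 / π) := by
    rw [show (1 : ℝ) = Real.sqrt 1 by simp]
    refine Real.sqrt_lt_sqrt zero_le_one ?_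
    rw [lt_div_iff₀ hπ0]; nlinarith
  have hlt : 2 * (α p.1.I.n * q p.1.I.n / (Real.sqrt 2 * p.2)) <
      Real.sqrt 2 * q p.1.I.n * Real.sqrt (p.1.I.n * Real.log 2 / π) / p.2 := by
    rw [show 2 * (α p.1.I.n * q p.1.I.n / (Real.sqrt 2 * p.2)) = Real.sqrt 2 * q p.1.I.n * α p.1.I.n / p.2 by
      field_simp; nlinarith [hs2sq]]
    rw [div_lt_div_iff_of_pos_right hr]
    have hq2 : 0 < Real.sqrt 2 * q p.1.I.n := by positivity
    nlinarith
  linarith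

end Unique

/-! ### The objects of the direct experiment -/

/-- The type of the data of one block: a shift, `m` manufactured samples, and the (empty, `N_V = 0`)
verification batch of `Regev2009.blockLaw` with `K = 1`. [folklore] -/
abbrev Block (n Q m : ℕ) : Type :=
  ((Fin n → ZMod Q) × (Fin m → (Fin n → ZMod Q) × ZMod Q)) × (Fin 0 → (Fin n → ZMod Q) × ZMod (Q * 1))

/-- LOCAL GLUE. The level `k ≤ K_g` of block `j = (k, i)` (blocks coded by `finProdFinEquiv`, as in
`Regev2009.levelNoise`). [cite: RegevLWE2009, Lemma 3.7 (proof)] -/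
def blockLevel (Kg J : ℕ) (j : Fin ((Kg + 1) * J)) : ℕ := ((finProdFinEquiv.symm j).1 : ℕ)

/-- `blockLevel ≤ K_g`. [folklore] -/
theorem blockLevel_le (Kg J : ℕ) (j : Fin ((Kg + 1) * J)) : blockLevel Kg J j ≤ Kg :=
  Nat.lt_succ_iff.1 (finProdFinEquiv.symm j).1.isLt

/-- The blocks `(k, i)`, `i < J`, have level `k`. [folklore] -/
theorem blockLevel_finProdFinEquiv (Kg J : ℕ) (k : Fin (Kg + 1)) (i : Fin J) :
    blockLevel Kg J (finProdFinEquiv (k, i)) = k := by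
  simp [blockLevel]

/-- LOCAL GLUE. **The Gaussian parameter of the manufactured noise at level `k`**:
`α_k = √(π(4α²/25 + kα²/T))` — Regev's `e ∼ N(0, α_k²/(2π))`, i.e. density `∝ e^{-e²/(4α²/25 + kα²/T)}`,
a RATIONAL exponent for rational `α` (no digit of `π` is needed to sample it); `α_0² = (4π/25)α² ≈ α²/2`
plays the part of Regev's `(α/√2)²`, the levels `k·πα²/T` that of Lemma 3.7's grid of extra variances.
[cite: RegevLWE2009, Lemma 3.11 (proof: "`e` … normal") and Lemma 3.7 (proof: the grid)] -/
def levelParam (a : ℝ) (T k : ℕ) : ℝ := Real.sqrt (π * (4 * a ^ 2 / 25 + k * a ^ 2 / T))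

/-- LOCAL GLUE. **The width at which the machine samples the dual lattice**: `r' = r·√(π/3)`, so that
`e^{-π‖v‖²/r'²} = e^{-3‖v‖²/r²}` (rational exponent for rational `r`, `v ∈ Λ* ⊆ ℚⁿ`); `r ≤ r' ≤ 8r/7`.
[cite: Peikert2009, Prop. 3.2 with Prop. 2.8 (the sampler for `D_{Λ*,r}`)] -/
def directWidth (r : ℝ) : ℝ := r * Real.sqrt (π / 3)

/-- `r ≤ r'` (`π ≥ 3`). [folklore] -/
theorem le_directWidth {r : ℝ} (hr : 0 ≤ r) : r ≤ directWidth r := by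
  unfold directWidth
  have h1 : 1 ≤ Real.sqrt (π / 3) := by
    rw [Real.le_sqrt zero_le_one (by positivity)]
    linarith [Real.pi_gt_three]
  exact le_mul_of_one_le_right hr h1

/-- `r' ≤ (8/7)·r` (`π/3 ≤ 64/49`). [folklore] -/
theorem directWidth_le {r : ℝ} (hr : 0 ≤ r) : directWidth r ≤ 8 / 7 * r := by
  unfold directWidth
  have h1 : Real.sqrt (π / 3) ≤ 8 / 7 := by
    rw [Real.sqrt_le_left (by norm_num)]
    linarith [Real.pi_lt_d2]
  nlinarith

/-- `0 < α_k` for `α > 0`. [folklore] -/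
theorem levelParam_pos {a : ℝ} (ha : 0 < a) (T k : ℕ) : 0 < levelParam a T k := by
  unfold levelParam
  refine Real.sqrt_pos.2 (mul_pos Real.pi_pos ?_)
  have h1 : 0 < 4 * a ^ 2 / 25 := by positivity
  have h2 : 0 ≤ (k : ℝ) * a ^ 2 / T := by positivity
  linarith

/-- `α_k² = 4πα²/25 + k·(πα²/T)`. [folklore] -/
theorem levelParam_sq (a : ℝ) (T k : ℕ) :
    levelParam a T k ^ 2 = π * (4 * a ^ 2 / 25) + k * (π * a ^ 2 / T) := by
  unfold levelParam
  rw [Real.sq_sqrt (by positivity)]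
  ring

/-- `(6/7)·α/√2 ≤ α_k`: the manufactured noise dominates the distance term in Regev's hypothesis
`r'‖x - κ‖ ≤ α_k·q`. [folklore] -/
theorem six_sevenths_le_levelParam {a : ℝ} (ha : 0 < a) (T k : ℕ) :
    6 / 7 * (a / Real.sqrt 2) ≤ levelParam a T k := by
  have hs2 : (0 : ℝ) < Real.sqrt 2 := Real.sqrt_pos.2 two_pos
  have hs2sq : Real.sqrt 2 ^ 2 = 2 := Real.sq_sqrt zero_le_two
  have hlhs : 0 ≤ 6 / 7 * (a / Real.sqrt 2) := by positivity
  rw [← Real.sqrt_sq hlhs]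
  unfold levelParam
  refine Real.sqrt_le_sqrt ?_
  have h2 : 0 ≤ (k : ℝ) * a ^ 2 / T := by positivity
  rw [mul_pow, div_pow, div_pow, hs2sq]
  nlinarith [Real.pi_gt_three, sq_nonneg a]

section Objects

variable (p : GapCVPInstance) [IsZLattice ℝ p.1.I.lattice] (Q : ℕ) [NeZero Q] (a : ℝ)

/-- LOCAL GLUE. **The deterministic verification test**: accept the candidate secret `c` iff the lattice
vector `B·digitOutput(c)` it leads to (one digit of Lemma 3.5, then Babai) lies within `αq/(√2 r)` of the
target, `‖x - B·digitOutput(c)‖² ≤ α²q²/(2r²)` — exact integer/rational arithmetic for a machine; as an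
acceptance family in the format of `Regev2009.firstAccepted` it is constant in the (empty) verification
batch. [cite: Peikert2009, Prop. 3.2 (full version p. 11: "the unique `v ∈ Λ` closest to `x`"); RegevLWE2009, Lemma 3.5] -/
def distAcc (c : Fin p.1.I.n → ZMod Q) : Set (Fin 0 → (Fin p.1.I.n → ZMod Q) × ZMod (Q * 1)) :=
  {_v | ‖p.1.targetE - intVecToEuclidean p.1.I.n (coeffVec p.1.I (digitOutput (zBasis p.1.I) Q p.1.targetE c))‖ ^ 2 ≤
      a ^ 2 * (Q : ℝ) ^ 2 / (2 * (p.2 : ℝ) ^ 2)}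

/-- LOCAL GLUE. **The law of the data of block `j`** of the direct experiment: a uniform shift (Lemma 4.1),
`m` manufactured samples `(B^∨⁻¹v mod q, ⌊q(⟨x,v⟩/q + e)⌉ mod q)` from independent dual-lattice samples
`v ← D` with noise parameter `α_k` of the block's level (Lemma 3.11), and the empty verification batch.
[cite: RegevLWE2009, Lemma 3.4 (proof = §3.2.1); Peikert2009, Prop. 3.2] -/
def directBlock (m T Kg J : ℕ) (D : PMF (dualLattice p.1.I.lattice)) (j : Fin ((Kg + 1) * J)) :
    PMF (Block p.1.I.n Q m) :=
  prodLaw (prodLaw (PMF.uniformOfFintype (Fin p.1.I.n → ZMod Q))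
      (iidPMF (bddLWESampleOf (dualZBasis p.1.I) Q D p.1.targetE (levelParam a T (blockLevel Kg J j))) m))
    (PMF.pure Fin.elim0)

/-- LOCAL GLUE. **The output of the direct experiment** on the data: the candidate of the first block
passing the distance test (`Regev2009.firstAccepted` with `K = 1`, `N_V = 0`), taken through the digit/Babai
step; `none` if no block passes. [cite: RegevLWE2009, Lemma 3.4 (proof = §3.2.1); Peikert2009, Prop. 3.2] -/
def directOutput (m Kg J : ℕ) (F : (Fin m → (Fin p.1.I.n → ZMod Q) × ZMod Q) → Fin p.1.I.n → ZMod Q)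
    (dat : Fin ((Kg + 1) * J) → Block p.1.I.n Q m) : Option (Fin p.1.I.n → ℤ) :=
  (firstAccepted Q 1 m 0 F (distAcc p Q a) dat).map (digitOutput (zBasis p.1.I) Q p.1.targetE)

end Objects

/-! ### The test accepts exactly the true secret -/

section Test

variable {q : ℕ → ℕ} [∀ n, NeZero (q n)] {α f : ℕ → ℝ}

/-- `B·z` read in `ℝⁿ` determines `z` on a nonsingular instance. [folklore] -/
theorem ofCoeffs_injective' (I : LatticeInstance) [IsZLattice ℝ I.lattice] : Function.Injective I.ofCoeffs := by
  intro z w h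
  have h0 : I.ofCoeffs (z - w) = 0 := by rw [ofCoeffs_sub, h, sub_self]
  exact sub_eq_zero.1 ((ofCoeffs_eq_zero_iff (isNonsingular_of_isZLattice I) _).1 h0)

/-- The digit step returns coordinates congruent to the candidate: `digitOutput(c) ≡ c (mod q)`. [cite: RegevLWE2009, Lemma 3.5 (proof)] -/
theorem intCast_digitOutput (p : GapCVPInstance) [IsZLattice ℝ p.1.I.lattice] (Q : ℕ) [NeZero Q]
    (c : Fin p.1.I.n → ZMod Q) (i : Fin p.1.I.n) :
    ((digitOutput (zBasis p.1.I) Q p.1.targetE c i : ℤ) : ZMod Q) = c i := by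
  unfold digitOutput
  push_cast
  rw [ZMod.natCast_self, zero_mul, zero_add, ZMod.natCast_zmod_val]

/-- **The test accepts the true secret**: `B·digitOutput(s) = κ` (one digit of Lemma 3.5 plus Babai,
`digitOutput_eq_repr`) and `‖x - κ‖ = dist(x, Λ) ≤ αq/(√2 r)`. [cite: RegevLWE2009, Lemma 3.5; Peikert2009, Prop. 3.2] -/
theorem distAcc_self (p : GapCVPInstance) [IsZLattice ℝ p.1.I.lattice] (hadm : BDDAdmissible q α f p)
    (hα : 0 ≤ α p.1.I.n) (κ : p.1.I.lattice) (hκ : dist p.1.targetE κ = infDist p.1.targetE p.1.I.lattice)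
    (hxB : ∀ i, ‖p.1.targetE - (κ : EuclideanSpace ℝ (Fin p.1.I.n))‖ / q p.1.I.n <
      ‖InnerProductSpace.gramSchmidt ℝ
        (fun i => ((zBasis p.1.I i : p.1.I.lattice) : EuclideanSpace ℝ (Fin p.1.I.n))) i‖ / 2) :
    distAcc p (q p.1.I.n) (α p.1.I.n) (fun i => (((zBasis p.1.I).repr κ i : ℤ) : ZMod (q p.1.I.n))) = Set.univ := by
  obtain ⟨-, hr0, -, -, hdist⟩ := hadm
  have hr : (0 : ℝ) < p.2 := by exact_mod_cast hr0
  have hq : (0 : ℝ) ≤ q p.1.I.n := Nat.cast_nonneg _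
  refine Set.eq_univ_iff_forall.2 fun v => ?_
  simp only [distAcc, Set.mem_setOf_eq]
  rw [digitOutput_eq_repr (zBasis p.1.I) (q p.1.I.n) p.1.targetE κ (gramSchmidt_zBasis_ne_zero p.1.I) hxB,
    intVecToEuclidean_coeffVec, ofCoeffs_repr, ← dist_eq_norm, hκ]
  have hρ : 0 ≤ α p.1.I.n * q p.1.I.n / (Real.sqrt 2 * p.2) := by positivity
  have h0 : 0 ≤ infDist p.1.targetE p.1.I.lattice := infDist_nonneg
  have hs2 : Real.sqrt 2 ^ 2 = 2 := Real.sq_sqrt zero_le_two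
  calc infDist p.1.targetE p.1.I.lattice ^ 2 ≤ (α p.1.I.n * q p.1.I.n / (Real.sqrt 2 * p.2)) ^ 2 :=
        pow_le_pow_left₀ h0 hdist 2
    _ = α p.1.I.n ^ 2 * (q p.1.I.n : ℝ) ^ 2 / (2 * (p.2 : ℝ) ^ 2) := by rw [div_pow, mul_pow, mul_pow, hs2]

/-- **The test rejects every wrong candidate** (dimension `n ≥ 5`, `α ≤ 1`): if `B·digitOutput(c)` is within
`αq/(√2 r)` of the target then it is the closest vector `κ` (`eq_closest_of_norm_sub_le`), so
`digitOutput(c) = B⁻¹κ` and `c ≡ digitOutput(c) = B⁻¹κ (mod q)` is the true secret.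
[cite: Peikert2009, Prop. 3.2 (full version p. 11); RegevLWE2009, Lemma 3.5] -/
theorem distAcc_eq_empty (p : GapCVPInstance) [IsZLattice ℝ p.1.I.lattice] (hadm : BDDAdmissible q α f p)
    (hn : 5 ≤ p.1.I.n) (hα : 0 ≤ α p.1.I.n) (hα1 : α p.1.I.n ≤ 1)
    (κ : p.1.I.lattice) (hκ : dist p.1.targetE κ = infDist p.1.targetE p.1.I.lattice)
    {c : Fin p.1.I.n → ZMod (q p.1.I.n)} (hc : c ≠ fun i => (((zBasis p.1.I).repr κ i : ℤ) : ZMod (q p.1.I.n))) :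
    distAcc p (q p.1.I.n) (α p.1.I.n) c = ∅ := by
  have hr : (0 : ℝ) < p.2 := by exact_mod_cast hadm.2.1
  have hq : (0 : ℝ) ≤ q p.1.I.n := Nat.cast_nonneg _
  refine Set.eq_empty_iff_forall_notMem.2 fun v hv => hc ?_
  simp only [distAcc, Set.mem_setOf_eq] at hv
  set z := digitOutput (zBasis p.1.I) (q p.1.I.n) p.1.targetE c with hz
  have hρ : 0 ≤ α p.1.I.n * q p.1.I.n / (Real.sqrt 2 * p.2) := by positivity
  have hs2 : Real.sqrt 2 ^ 2 = 2 := Real.sq_sqrt zero_le_two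
  have hle : ‖p.1.targetE - intVecToEuclidean p.1.I.n (coeffVec p.1.I z)‖ ≤ α p.1.I.n * q p.1.I.n / (Real.sqrt 2 * p.2) := by
    refine (pow_le_pow_iff_left₀ (norm_nonneg _) hρ two_ne_zero).1 (hv.trans_eq ?_)
    rw [div_pow, mul_pow, mul_pow, hs2]
  rw [intVecToEuclidean_coeffVec] at hle
  have heq := eq_closest_of_norm_sub_le p hadm hn hα1 κ hκ (p.1.I.ofCoeffs_mem_lattice z) hle
  rw [← ofCoeffs_repr] at heq
  have hzκ : z = fun i => (zBasis p.1.I).repr κ i := ofCoeffs_injective' p.1.I heq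
  funext i
  rw [← intCast_digitOutput p (q p.1.I.n) c i, ← hz, hzκ]

end Test

/-! ### The failure bound of the direct experiment -/

section Main

variable {q : ℕ → ℕ} [∀ n, NeZero (q n)] {α f : ℕ → ℝ}

/-- The `J` blocks of level `k`. [folklore] -/
theorem card_image_level (Kg J : ℕ) (k : Fin (Kg + 1)) :
    (univ.image fun i : Fin J => finProdFinEquiv (k, i)).card = J := by
  rw [card_image_of_injective _ fun i i' h => by simpa using h, card_univ, Fintype.card_fin]

/-- **The direct block is within `m(δ + 6ε)` of the ideal block** with oracle noise `Ψ̄_{β_k}`,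
`β_k = √((r'‖x - κ‖/q)² + α_k²)`, secret `s = (Λ*)⁻¹κ mod q` (Lemma 3.11 per sample, `m` samples, equal
shift and verification components). [cite: RegevLWE2009, Lemma 3.11 with Lemma 3.7 (proof)] -/
theorem tvDist_directBlock_blockLaw_le (p : GapCVPInstance) [IsZLattice ℝ p.1.I.lattice] (Q : ℕ) [NeZero Q]
    {a : ℝ} (ha : 0 < a) (m T Kg J : ℕ) (D : PMF (dualLattice p.1.I.lattice)) {δ ε r' : ℝ}
    (hD : D.tvDist (discreteGaussian (dualLattice p.1.I.lattice) r' 0) ≤ δ) (hε : 0 < ε) (hε' : ε ≤ 1 / 2)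
    (hr' : 0 < r') (hη : Real.sqrt 2 * Q * smoothingParameter (dualLattice p.1.I.lattice) ε ≤ r')
    {κ : EuclideanSpace ℝ (Fin p.1.I.n)} (hκ : κ ∈ dualLattice (dualLattice p.1.I.lattice))
    (hx : r' * ‖p.1.targetE - κ‖ ≤ 6 / 7 * (a / Real.sqrt 2) * Q) (χV : PMF (ZMod (Q * 1)))
    (j : Fin ((Kg + 1) * J)) :
    (directBlock p Q a m T Kg J D j).tvDist
      (blockLaw Q 1 m 0
        (discretizedGaussian Q (Real.sqrt ((r' * ‖p.1.targetE - κ‖ / Q) ^ 2 + levelParam a T (blockLevel Kg J j) ^ 2)))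
        χV (secretOf (dualZBasis p.1.I) Q κ)) ≤ m * (δ + 6 * ε) := by
  have hαk := levelParam_pos ha T (blockLevel Kg J j)
  have hxk : r' * ‖p.1.targetE - κ‖ ≤ levelParam a T (blockLevel Kg J j) * Q :=
    hx.trans (mul_le_mul_of_nonneg_right (six_sevenths_le_levelParam ha T _) (Nat.cast_nonneg Q))
  have h1 := tvDist_iidPMF_bddLWESampleOf_lweSamples_le (dualZBasis p.1.I) Q D hD hε hε' hr' hαk hη hκ hxk m
  unfold directBlock blockLaw
  refine (tvDist_prodLaw_le _ _ _ _).trans ?_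
  rw [iidPMF_zero, PMF.tvDist_self, add_zero]
  refine (tvDist_prodLaw_le _ _ _ _).trans ?_
  rw [PMF.tvDist_self, zero_add]
  exact h1

set_option maxHeartbeats 800000 in
/-- **Peikert 2009, Prop. 3.2 / Regev 2009, Lemma 3.4 with a deterministic verification — the failure
bound of the direct experiment over real block laws.** On an `f`-admissible input `((B, x), r)` with the
slack distance bound `dist(x, Λ) ≤ (3/4)·αq/(√2 r)` (`BDDAdmissibleS`), of dimension `n ≥ 5`, with
`0 < α ≤ 1` and `√2·α < f√(log n)` (one digit suffices): for every sampler `D` within `δ` of `D_{Λ*,r'}`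
(`r' = r√(π/3)`), every oracle `F` of average-case success `≥ 2/3` on `LWE_{q,Ψ̄_α}` from `m` samples,
parameters `T ≥ max(2, 100m)`, `T + 3 ≤ 3K_g`, and every family of real block laws `P_j` each within `τ` of
`directBlock`, if `m(δ + 6·2⁻ⁿ) + τ ≤ 1/10` then, `κ` denoting the closest vector,
`Pr_{⊗ⱼ Pⱼ}[directOutput ≠ some (B⁻¹κ)] ≤ 2^{-J}`. The fitting level (`exists_level_of_grid`) has `J`
blocks on which the oracle succeeds with probability `≥ 2/3 - mπ/T`, the test never errs
(`distAcc_eq_empty`, `distAcc_self`), and `toReal_firstAccepted_ne_le_of_tvDist` gives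
`(1/3 + mπ/T + 1/10)^J ≤ 2^{-J}`. [cite: Peikert2009, Prop. 3.2 with Prop. 2.8 and the proof of Thm. 3.1 (full version pp. 11–12); RegevLWE2009, Lemma 3.4 with Lemmas 3.5, 3.7, 3.11, 4.1] -/
theorem toReal_directOutput_ne_le (p : GapCVPInstance) [IsZLattice ℝ p.1.I.lattice]
    (hadm : BDDAdmissible q α f p)
    (hslack : infDist p.1.targetE p.1.I.lattice ≤ 3 / 4 * (α p.1.I.n * q p.1.I.n / (Real.sqrt 2 * p.2)))
    (hn : 5 ≤ p.1.I.n) (hα : 0 < α p.1.I.n) (hα1 : α p.1.I.n ≤ 1)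
    (hgap : Real.sqrt 2 * α p.1.I.n < f p.1.I.n * Real.sqrt (Real.log p.1.I.n))
    (D : PMF (dualLattice p.1.I.lattice)) {δ : ℝ} (hδ : 0 ≤ δ)
    (hD : D.tvDist (discreteGaussian (dualLattice p.1.I.lattice) (directWidth p.2) 0) ≤ δ)
    (m T Kg J : ℕ) (hT : 100 * m ≤ T) (hT2 : 2 ≤ T) (hKg : T + 3 ≤ 3 * Kg)
    (F : (Fin m → (Fin p.1.I.n → ZMod (q p.1.I.n)) × ZMod (q p.1.I.n)) → Fin p.1.I.n → ZMod (q p.1.I.n))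
    (hF : ENNReal.ofReal (2 / 3) ≤
      searchSuccessProb (discretizedGaussian (q p.1.I.n) (α p.1.I.n)) m fun B => PMF.pure (F B))
    (P : Fin ((Kg + 1) * J) → PMF (Block p.1.I.n (q p.1.I.n) m)) {τ : ℝ} (hτ0 : 0 ≤ τ)
    (hP : ∀ j, (P j).tvDist (directBlock p (q p.1.I.n) (α p.1.I.n) m T Kg J D j) ≤ τ)
    (hsmall : m * (δ + 6 * (2⁻¹ : ℝ) ^ p.1.I.n) + τ ≤ 1 / 10) :
    ∃ κ : p.1.I.lattice, dist p.1.targetE κ = infDist p.1.targetE p.1.I.lattice ∧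
      ((indepLaw ((Kg + 1) * J) P).toOuterMeasure
          {dat | directOutput p (q p.1.I.n) (α p.1.I.n) m Kg J F dat ≠
            some (fun i => (zBasis p.1.I).repr κ i)}).toReal ≤ (1 / 2) ^ J := by
  classical
  obtain ⟨κ, hκ⟩ := exists_closest p.1.I p.1.targetE
  refine ⟨κ, hκ, ?_⟩
  obtain ⟨-, hr0, hGSr, hη, hdist⟩ := hadm
  -- abbreviations and positivity
  have hr : (0 : ℝ) < p.2 := by exact_mod_cast hr0
  have hq : (0 : ℝ) < q p.1.I.n := Nat.cast_pos.2 (Nat.pos_of_ne_zero (NeZero.ne (q p.1.I.n)))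
  have hs2 : (0 : ℝ) < Real.sqrt 2 := Real.sqrt_pos.2 two_pos
  have hs2sq : Real.sqrt 2 * Real.sqrt 2 = 2 := Real.mul_self_sqrt zero_le_two
  have hn1 : 1 ≤ p.1.I.n := by omega
  set r' := directWidth (p.2 : ℝ) with hr'def
  have hrr' : (p.2 : ℝ) ≤ r' := le_directWidth hr.le
  have hr'le : r' ≤ 8 / 7 * p.2 := directWidth_le hr.le
  have hr'pos : 0 < r' := hr.trans_le hrr'
  set x := p.1.targetE with hxdef
  -- `ε = 2⁻ⁿ`
  have hε : (0 : ℝ) < (2⁻¹ : ℝ) ^ p.1.I.n := by positivity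
  have hε' : (2⁻¹ : ℝ) ^ p.1.I.n ≤ 1 / 2 := by
    calc (2⁻¹ : ℝ) ^ p.1.I.n ≤ (2⁻¹ : ℝ) ^ 1 := pow_le_pow_of_le_one (by norm_num) (by norm_num) hn1
      _ = 1 / 2 := by norm_num
  -- the secret and the digit step
  have hb := inner_zBasis_dualZBasis p.1.I
  have hκL : (κ : EuclideanSpace ℝ (Fin p.1.I.n)) ∈ dualLattice (dualLattice p.1.I.lattice) :=
    coe_mem_dualLattice_of_biorth (zBasis p.1.I) (dualZBasis p.1.I) hb κ
  set s : Fin p.1.I.n → ZMod (q p.1.I.n) := secretOf (dualZBasis p.1.I) (q p.1.I.n) (κ : EuclideanSpace ℝ (Fin p.1.I.n)) with hs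
  have hsecret : s = fun i => (((zBasis p.1.I).repr κ i : ℤ) : ZMod (q p.1.I.n)) :=
    secretOf_eq_of_biorth (zBasis p.1.I) (dualZBasis p.1.I) (q p.1.I.n) hb κ
  have hxκ : ‖x - (κ : EuclideanSpace ℝ (Fin p.1.I.n))‖ = infDist x p.1.I.lattice := by
    rw [← dist_eq_norm]; exact hκ
  -- the one-digit Babai condition (as in `toReal_regevBDD_ne_le_of_admissible`)
  have hxB : ∀ i, ‖x - (κ : EuclideanSpace ℝ (Fin p.1.I.n))‖ / q p.1.I.n <
      ‖InnerProductSpace.gramSchmidt ℝ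
        (fun i => ((zBasis p.1.I i : p.1.I.lattice) : EuclideanSpace ℝ (Fin p.1.I.n))) i‖ / 2 := by
    intro i
    have hfun : (fun i => ((zBasis p.1.I i : p.1.I.lattice) : EuclideanSpace ℝ (Fin p.1.I.n))) = p.1.I.vec :=
      funext (coe_zBasis p.1.I)
    rw [hfun]
    have hGS := hGSr i
    have h1 : ‖x - (κ : EuclideanSpace ℝ (Fin p.1.I.n))‖ / q p.1.I.n ≤ α p.1.I.n / (Real.sqrt 2 * p.2) := by
      rw [div_le_iff₀ hq, hxκ]
      calc infDist x p.1.I.lattice ≤ α p.1.I.n * q p.1.I.n / (Real.sqrt 2 * p.2) := hdist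
        _ = α p.1.I.n / (Real.sqrt 2 * p.2) * q p.1.I.n := by ring
    have h2 : α p.1.I.n / (Real.sqrt 2 * p.2) < ‖InnerProductSpace.gramSchmidt ℝ p.1.I.vec i‖ / 2 := by
      rw [div_lt_div_iff₀ (by positivity) two_pos]
      have h3 : f p.1.I.n * Real.sqrt (Real.log p.1.I.n) * Real.sqrt 2 ≤
          p.2 * ‖InnerProductSpace.gramSchmidt ℝ p.1.I.vec i‖ * Real.sqrt 2 :=
        mul_le_mul_of_nonneg_right hGS hs2.le
      nlinarith [h3, hgap, hs2sq, hr, hs2]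
    exact h1.trans_lt h2
  -- the distance term: `r'‖x - κ‖ ≤ (6/7)(α/√2) q`
  have hx6 : r' * ‖x - (κ : EuclideanSpace ℝ (Fin p.1.I.n))‖ ≤ 6 / 7 * (α p.1.I.n / Real.sqrt 2) * q p.1.I.n := by
    rw [hxκ]
    calc r' * infDist x p.1.I.lattice ≤ (8 / 7 * p.2) * (3 / 4 * (α p.1.I.n * q p.1.I.n / (Real.sqrt 2 * p.2))) :=
          mul_le_mul hr'le hslack infDist_nonneg (by positivity)
      _ = 6 / 7 * (α p.1.I.n / Real.sqrt 2) * q p.1.I.n := by field_simp; ring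
  have hη' : Real.sqrt 2 * q p.1.I.n * smoothingParameter (dualLattice p.1.I.lattice) ((2⁻¹ : ℝ) ^ p.1.I.n) ≤ r' :=
    hη.trans hrr'
  -- the grid: `u = (r'‖x-κ‖/q)² + 4πα²/25`, `Δ = πα²/T`
  set u : ℝ := (r' * ‖x - (κ : EuclideanSpace ℝ (Fin p.1.I.n))‖ / q p.1.I.n) ^ 2 + π * (4 * α p.1.I.n ^ 2 / 25) with hu
  set Δ : ℝ := π * α p.1.I.n ^ 2 / T with hΔ
  have hT0 : (0 : ℝ) < T := by exact_mod_cast (lt_of_lt_of_le two_pos hT2)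
  have hTR : (2 : ℝ) ≤ T := by exact_mod_cast hT2
  have hπ3 := Real.pi_gt_three
  have hπ4 := Real.pi_lt_d2
  have hα2 : 0 < α p.1.I.n ^ 2 := pow_pos hα 2
  have hΔpos : 0 < Δ := by rw [hΔ]; positivity
  have hΔ3 : Δ ≤ 3 * α p.1.I.n ^ 2 := by
    rw [hΔ, div_le_iff₀ hT0]; nlinarith
  have hu0 : 0 ≤ u := by rw [hu]; positivity
  have hdq : r' * ‖x - (κ : EuclideanSpace ℝ (Fin p.1.I.n))‖ / q p.1.I.n ≤ 6 / 7 * (α p.1.I.n / Real.sqrt 2) := by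
    rw [div_le_iff₀ hq]; exact hx6
  have hdq0 : 0 ≤ r' * ‖x - (κ : EuclideanSpace ℝ (Fin p.1.I.n))‖ / q p.1.I.n := by positivity
  have hu1 : u ≤ α p.1.I.n ^ 2 := by
    have h1 : (r' * ‖x - (κ : EuclideanSpace ℝ (Fin p.1.I.n))‖ / q p.1.I.n) ^ 2 ≤ (6 / 7 * (α p.1.I.n / Real.sqrt 2)) ^ 2 :=
      pow_le_pow_left₀ hdq0 hdq 2
    have h2 : (6 / 7 * (α p.1.I.n / Real.sqrt 2)) ^ 2 = 36 / 49 * (α p.1.I.n ^ 2 / 2) := by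
      rw [mul_pow, div_pow, div_pow, Real.sq_sqrt zero_le_two]; ring
    rw [hu]; nlinarith
  have hKg' : α p.1.I.n ^ 2 / Δ + 1 ≤ Kg := by
    have hKgR : (T : ℝ) + 3 ≤ 3 * Kg := by exact_mod_cast hKg
    have h1 : α p.1.I.n ^ 2 / Δ = T / π := by
      rw [hΔ]; field_simp
    rw [h1]
    have h2 : (T : ℝ) / π ≤ T / 3 := div_le_div_of_nonneg_left hT0.le three_pos hπ3.le
    linarith
  obtain ⟨k, hkKg, hlow, hup, htv⟩ := exists_level_of_grid (q p.1.I.n) hα hu0 hu1 hΔpos hΔ3 hKg'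
  -- the good blocks: level `k`
  set kF : Fin (Kg + 1) := ⟨k, Nat.lt_succ_of_le hkKg⟩ with hkF
  set Tset : Finset (Fin ((Kg + 1) * J)) := univ.image fun i : Fin J => finProdFinEquiv (kF, i) with hTset
  have hTcard : Tset.card = J := card_image_level Kg J kF
  have hlevel : ∀ j ∈ Tset, blockLevel Kg J j = k := by
    intro j hj
    rw [hTset, mem_image] at hj
    obtain ⟨i, -, rfl⟩ := hj
    rw [blockLevel_finProdFinEquiv]
  -- the widths of the ideal blocks
  set βO : Fin ((Kg + 1) * J) → ℝ := fun j =>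
    Real.sqrt ((r' * ‖x - (κ : EuclideanSpace ℝ (Fin p.1.I.n))‖ / q p.1.I.n) ^ 2 + levelParam (α p.1.I.n) T (blockLevel Kg J j) ^ 2)
    with hβO
  have hβgood : ∀ j ∈ Tset, βO j = Real.sqrt (u + k * Δ) := by
    intro j hj
    rw [hβO]
    simp only
    rw [hlevel j hj, levelParam_sq, hu, hΔ]
    ring_nf
  set χV : PMF (ZMod (q p.1.I.n * 1)) := discretizedGaussian (q p.1.I.n * 1) (α p.1.I.n) with hχV
  -- per-block closeness: `Δ(P j, ideal j) ≤ τ + m(δ + 6ε)`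
  have hτ' : ∀ j ∈ Tset, (P j).tvDist (blockLaw (q p.1.I.n) 1 m 0 (discretizedGaussian (q p.1.I.n) (βO j)) χV s) ≤
      τ + m * (δ + 6 * (2⁻¹ : ℝ) ^ p.1.I.n) := by
    intro j _
    have h1 := tvDist_directBlock_blockLaw_le p (q p.1.I.n) hα m T Kg J D hD hε hε' hr'pos hη' hκL hx6 χV j
    exact (PMF.tvDist_triangle_holds _ _ _).trans (add_le_add (hP j) h1)
  -- the oracle on the good blocks: success `≥ 2/3 - m·Δ/α²`
  have hσ : ∀ j ∈ Tset, 2 / 3 - m * (Δ / α p.1.I.n ^ 2) ≤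
      (searchSuccessProb (discretizedGaussian (q p.1.I.n) (βO j)) m fun B => PMF.pure (F B)).toReal := by
    intro j hj
    rw [hβgood j hj]
    have h1 := two_thirds_le_toReal (searchSuccessProb_le_one_holds _ _ _) hF
    have h2 := toReal_searchSuccessProb_sub_le (discretizedGaussian (q p.1.I.n) (α p.1.I.n))
      (discretizedGaussian (q p.1.I.n) (Real.sqrt (u + k * Δ))) m fun B => PMF.pure (F B)
    rw [PMF.tvDist_comm] at h2
    have h3 := mul_le_mul_of_nonneg_left htv (Nat.cast_nonneg m)
    linarith only [h1, h2, h3]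
  -- the test never errs
  have hA : ∀ c, c ≠ s → distAcc p (q p.1.I.n) (α p.1.I.n) c = ∅ := fun c hc =>
    distAcc_eq_empty p ⟨isNonsingular_of_isZLattice p.1.I, hr0, hGSr, hη, hdist⟩ hn hα.le hα1 κ hκ (by rwa [← hsecret])
  have hRacc : distAcc p (q p.1.I.n) (α p.1.I.n) s = Set.univ := by
    rw [hsecret]
    exact distAcc_self p ⟨isNonsingular_of_isZLattice p.1.I, hr0, hGSr, hη, hdist⟩ hα.le κ hκ hxB
  -- the generic bound
  have hmain := toReal_firstAccepted_ne_le_of_tvDist P (fun j => discretizedGaussian (q p.1.I.n) (βO j)) χV s F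
    (distAcc p (q p.1.I.n) (α p.1.I.n)) hA hRacc Tset hσ hτ'
  rw [hTcard] at hmain
  -- the output fails only if the secret was not found
  have hsub : {dat | directOutput p (q p.1.I.n) (α p.1.I.n) m Kg J F dat ≠ some (fun i => (zBasis p.1.I).repr κ i)} ⊆
      {dat | firstAccepted (q p.1.I.n) 1 m 0 F (distAcc p (q p.1.I.n) (α p.1.I.n)) dat ≠ some s} := by
    intro dat hdat hfa
    apply hdat
    simp only [directOutput, hfa, Option.map_some, hsecret]
    rw [digitOutput_eq_repr (zBasis p.1.I) (q p.1.I.n) x κ (gramSchmidt_zBasis_ne_zero p.1.I) hxB]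
  -- numerics: `1 - (2/3 - mΔ/α²) + (τ + m(δ + 6ε)) ≤ 1/2`
  have hmΔ : (m : ℝ) * (Δ / α p.1.I.n ^ 2) ≤ 1 / 25 := by
    have h1 : Δ / α p.1.I.n ^ 2 = π / T := by rw [hΔ]; field_simp
    rw [h1]
    have hmT : 100 * (m : ℝ) ≤ T := by exact_mod_cast hT
    rw [mul_div_assoc', div_le_iff₀ hT0]
    nlinarith [(Nat.cast_nonneg m : (0 : ℝ) ≤ m), hπ4, hmT]
  have hbase0 : 0 ≤ 1 - (2 / 3 - m * (Δ / α p.1.I.n ^ 2)) + (τ + m * (δ + 6 * (2⁻¹ : ℝ) ^ p.1.I.n)) := by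
    have h1 : 0 ≤ (m : ℝ) * (δ + 6 * (2⁻¹ : ℝ) ^ p.1.I.n) := by positivity
    have h2 : 0 ≤ (m : ℝ) * (Δ / α p.1.I.n ^ 2) := by positivity
    linarith only [h1, h2, hτ0]
  have hbase : 1 - (2 / 3 - m * (Δ / α p.1.I.n ^ 2)) + (τ + m * (δ + 6 * (2⁻¹ : ℝ) ^ p.1.I.n)) ≤ 1 / 2 := by
    linarith only [hmΔ, hsmall]
  calc ((indepLaw ((Kg + 1) * J) P).toOuterMeasure _).toReal
      ≤ ((indepLaw ((Kg + 1) * J) P).toOuterMeasure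
          {dat | firstAccepted (q p.1.I.n) 1 m 0 F (distAcc p (q p.1.I.n) (α p.1.I.n)) dat ≠ some s}).toReal :=
        ENNReal.toReal_mono (pmf_toOuterMeasure_ne_top _ _) (OuterMeasure.mono _ hsub)
    _ ≤ (1 - (2 / 3 - m * (Δ / α p.1.I.n ^ 2)) + (τ + m * (δ + 6 * (2⁻¹ : ℝ) ^ p.1.I.n))) ^ J := hmain
    _ ≤ (1 / 2) ^ J := pow_le_pow_left₀ hbase0 hbase J

end Main

end Peikert2009

end Literature.Computability.Cryptography

end
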